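import Summits.AnomalousDissipation.AnomalousDissipation.Theses.StirringSphere
import Summits.AnomalousDissipation.AnomalousDissipation.Cruxes.NoScreening.KleinPoleSketch
import Literature.Analysis.FluidPDE.LinearizedNSTorus

/-!
# Crux `NoScreening` (stmt-AnomalousDissipation-17144) — ideator-1 sketch for the crux idea
# `tame-kantorovich-shear-triad` (negation side; feeds `KleinPole.QuietPolarSteadyStates`)

Only ELABORATION is required here (`sorry` marks what a disprover would prove).

The negation programme of `klein-pole-quiet-states` (strategist) and `polar-euler-screen` (sibling seat)
stops at ONE open step: `KleinPole.QuietPolarSteadyStates` — bounded steady states of `NS_ν(−b₂)` with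
vanishing dissipation along `ν → 0`.  This sketch types the TAME NEWTON–KANTOROVICH reduction of that step
to two LINEAR statements about the explicit operator `L(ν, u⋆) = νΔ − (u⋆·∇) − (·∇)u⋆ − ∇q`
(`Torus.linearizedNSOperator`) at the explicit Euler-balanced shear/cosine triad
`u⋆ = (2π)^{-1/2}(b₁ + b₁')`, in the `PT`-symmetric sector (`(PT u)(x) = −u(−x + (½,½,½))`), where the
Euler-circle tangent `t⋆ = (2π)^{-1/2}(b₀ − b₀')` (an exact `4π²ν`-eigenvector of the linearisation at
`u⋆`, `PT`-odd) is absent: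

* `TameFirstStep C₂ ν₁` — the first Newton correction `δ₁`, `L(ν,u⋆) δ₁ = 4π²ν u⋆` (the steady defect of
  `u⋆` is EXACTLY `−νΔu⋆ = 4π²ν u⋆`, `u⋆` being a Stokes eigenfunction of the first shell), is `O(ν)` in the
  analytic (Foias–Temam Gevrey) norm: numerically `‖δ₁‖_{L²} ≈ (17–20)·ν` for `ν ∈ [0.0025, 0.02]`
  (kit j026403, K = 6; the strategist's j025558 gave the same ratios 18–30 on the full space).
* `PseudospectralBound γ C₁ ν₁ σ σ'` — the inverse of `L(ν,u⋆)` on `PT`-symmetric solenoidal data grows at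
  most like `ν^{-γ}` between two Gevrey classes `σ' < σ` (no derivative gain is asked; a derivative LOSS is
  allowed, paid by the width `σ − σ'` — the analytic Newton scheme tolerates it because `u⋆` and `b₂` are
  entire).  The enhanced-dissipation literature proves exactly such bounds for Kolmogorov shears
  (`γ = ½` off the streak sector: Li–Wei–Zhang, arXiv:1801.05645 Thm 1.1 / §4.1; Ibrahim–Maekawa–Masmoudi
  arXiv:1710.05132; Wei–Zhang–Zhao) — the bet is `γ < 1` for the TRIAD of three orthogonal Kolmogorov
  shears, whose Lagrangian flow is numerically chaotic on 99.6 % of `T³` (FTLE ≈ 0.93, kit j026403), so that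
  no torus-averaged slow sector (`γ = 1`, Freidlin–Wentzell) is expected.
* `quietPolar_of_tameKantorovich` — the composition: `γ < 1` + tame first step ⇒
  `KleinPole.QuietPolarSteadyStates` (hence, with `KleinPole.not_noScreening_of_polar`, `¬ NoScreening`).
  Proof shape (L): analytic Newton scheme `u_{n+1} = u_n − L(ν,u_n)^{-1} F_ν(u_n)` from `u₁ = u⋆ + δ₁`,
  whose residual is `B(δ₁,δ₁) = O(ν²)`; each later step costs `ν^{-γ}` and a Cauchy loss, so the scheme
  is super-linearly convergent iff `ν^{2-γ} ≪ ν`, i.e. `γ < 1`; the limit is a classical steady state with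
  `‖u − u⋆‖ = O(ν)`, energy `→ 3/(2π) < ½` and dissipation `ν‖∇u‖² → 0` (= injection, energy equality of
  steady states in `V`), i.e. an admissible quiet polar steady state for every small `ν`.
* `UniformKantorovich h₀ C` / `quietPolar_of_uniformKantorovich` — the BORDERLINE form (`γ = 1` with constants),
  which is the one the symmetric-sector numerics support (kit j026477, K = 6/8 agree to 3 digits for
  `ν ≥ 0.0025`): on `Fix(S₃×PT)` the linearisation has NO singular value below `4π²ν` for `ν ≥ 0.0012`, but
  `σ_min ≈ (60–110)·ν` (viscous lift of the exact, K-growing kernel of `L_{u⋆}`: 6 at K = 6, 8 at K = 8),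
  so the plain exponent is `γ = 1` (local fits 1.0–1.6), NOT `< 1`; yet the Kantorovich number itself is flat:
  `h ≈ 0.19, 0.19, 0.17, 0.16, 0.15, 0.16 < ½` at `ν = 0.02 … 0.0018` (tame step `‖δ₁‖/ν = 15–23`, second
  Newton step / first = 0.17 → 0.061). Fixed-ν functional analysis in `H²` (no derivative loss at `ν > 0`),
  along a sequence of `ν` (generic `ν` avoid the isolated symmetry-breaking eigenvalue crossings).
* `newtonKantorovich_quadratic` — the abstract Banach-space core (quadratic maps), Mathlib-only statement.
-/

set_option linter.dupNamespace false

noncomputable section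

open MeasureTheory
open scoped BigOperators Real

namespace Summit.AnomalousDissipation.AnomalousDissipation.Cruxes.NoScreening.TameKantorovich

open Summit.AnomalousDissipation.AnomalousDissipation.Cruxes.NoScreening.KleinPole
  (stirB b1' sphereForce polarC IsAdmissibleSteadyState QuietPolarSteadyStates)

local notation "𝕋³" => UnitAddTorus (Fin 3)
local notation "E³" => EuclideanSpace ℝ (Fin 3)
local notation "ℂ³" => EuclideanSpace ℂ (Fin 3)

/-! ### The explicit objects -/

/-- The half-diagonal point `(½,½,½) ∈ T³`. -/
def halfShift : 𝕋³ := fun _ => ((2⁻¹ : ℝ) : UnitAddCircle)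

/-- `(PT u)(x) = −u(−x + (½,½,½))`: parity composed with the half-diagonal translation (the element of
the polar Klein group that fixes the triad `u⋆`). -/
def ptImage (u : 𝕋³ → E³) : 𝕋³ → E³ := fun x => -u (-x + halfShift)

/-- `u` is `PT`-symmetric. -/
def IsPTSymm (u : 𝕋³ → E³) : Prop := ptImage u = u

/-- The Euler-balanced polar state `u⋆ = (2π)^{-1/2}(b₁ + b₁')` (cosine triad; `(u⋆·∇)u⋆ + ∇q = −b₂`). -/
def uStar : 𝕋³ → E³ := fun x => (Real.sqrt (2 * π))⁻¹ • (stirB 1 x + b1' x)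

/-- Real fields viewed as complex fields (the linearised vocabulary of `LinearizedNSTorus` is complex). -/
def rtc (w : 𝕋³ → E³) : 𝕋³ → ℂ³ := fun x => Literature.Analysis.FluidPDE.Torus.realToComplex (w x)

/-- Foias–Temam Gevrey (analytic) norm, squared: `∑ₖ e^{2σ|k|} ‖ŵ(k)‖²` (junk `0` if not summable — only
used under smoothness/analyticity hypotheses). -/
def gevreyNormSq (σ : ℝ) (w : 𝕋³ → E³) : ℝ :=
  ∑' k : Fin 3 → ℤ, Real.exp (2 * σ * Real.sqrt (Literature.Analysis.FunctionSpaces.Torus.freqNormSq k)) *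
    ‖UnitAddTorus.mFourierCoeff (Literature.Analysis.FunctionSpaces.EuclideanSpace.complexify ∘ w) k‖ ^ 2

/-- Summability of the Gevrey series (finiteness of `gevreyNormSq σ w`, removing the `tsum` junk value). -/
def GevreySummable (σ : ℝ) (w : 𝕋³ → E³) : Prop :=
  Summable fun k : Fin 3 → ℤ =>
    Real.exp (2 * σ * Real.sqrt (Literature.Analysis.FunctionSpaces.Torus.freqNormSq k)) *
      ‖UnitAddTorus.mFourierCoeff (Literature.Analysis.FunctionSpaces.EuclideanSpace.complexify ∘ w) k‖ ^ 2

/-- Admissible linear data / unknowns: smooth, solenoidal, mean-zero, `PT`-symmetric real fields. -/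
def IsAdmissibleField (g : 𝕋³ → E³) : Prop :=
  Literature.Analysis.FunctionSpaces.Torus.IsSmooth g ∧ Literature.Analysis.FunctionSpaces.Torus.IsDivFree g ∧
    Literature.Analysis.FunctionSpaces.Torus.HasZeroMean g ∧ IsPTSymm g

/-! ### The two linear hypotheses -/

/-- **Tame first step.** For every small `ν` the first Newton correction `δ₁` — the solution of the
resolvent relation `L(ν,u⋆) δ₁ = 4π²ν·u⋆` (`Torus.LinNSResolventRel` at spectral parameter `0`) — exists in
the `PT`-symmetric sector and is `O(ν)` in the Gevrey class `σ`. -/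
def TameFirstStep (σ C₂ ν₁ : ℝ) : Prop :=
  ∀ ν : ℝ, 0 < ν → ν < ν₁ →
    ∃ δ : 𝕋³ → E³, IsAdmissibleField δ ∧ GevreySummable σ δ ∧
      Literature.Analysis.FluidPDE.Torus.LinNSResolventRel ν uStar 0 (rtc δ) (rtc (fun x => (4 * π ^ 2 * ν) • uStar x)) ∧
      gevreyNormSq σ δ ≤ (C₂ * ν) ^ 2

/-- **Pseudospectral bound with exponent `γ` near the triad (derivative loss allowed).** For every small
`ν`, every admissible base point `v` with `‖v − u⋆‖_σ ≤ r ν`, and every admissible `g`, the resolvent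
relation `L(ν,v) w = g` has a `PT`-symmetric solution with `‖w‖_{σ'} ≤ C₁ ν^{-γ} ‖g‖_{σ}` between the
Gevrey classes `σ' < σ` (an approximate-inverse hypothesis of Zehnder type; at `v = u⋆` it is the
pseudospectral bound proper, and for `γ < 1` it propagates formally to the `O(ν)`-ball by a Neumann series). -/
def PseudospectralBound (γ C₁ ν₁ σ σ' r : ℝ) : Prop :=
  ∀ ν : ℝ, 0 < ν → ν < ν₁ → ∀ v : 𝕋³ → E³,
    IsAdmissibleField (fun x => v x - uStar x) → GevreySummable σ (fun x => v x - uStar x) →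
    gevreyNormSq σ (fun x => v x - uStar x) ≤ (r * ν) ^ 2 →
    ∀ g : 𝕋³ → E³, IsAdmissibleField g → GevreySummable σ g →
      ∃ w : 𝕋³ → E³, IsAdmissibleField w ∧ GevreySummable σ' w ∧
        Literature.Analysis.FluidPDE.Torus.LinNSResolventRel ν v 0 (rtc w) (rtc g) ∧
        gevreyNormSq σ' w ≤ (C₁ * ν ^ (-γ)) ^ 2 * gevreyNormSq σ g

/-! ### First lemma: the tame Kantorovich reduction of `QuietPolarSteadyStates` -/

/-- **FIRST LEMMA (the line's load-bearing reduction; size L, standard analytic Newton scheme).**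
If the linearisation at the triad `u⋆` obeys a pseudospectral bound with SOME exponent `γ < 1` on a scale of
Gevrey classes and the first Newton step is tame (`O(ν)`), then along EVERY small `ν` there is an admissible
steady state of `NS_ν(−b₂)` within `O(ν)` of `u⋆`; in particular `KleinPole.QuietPolarSteadyStates` holds
(energy `≤ ½`, dissipation `ν‖∇u‖² → 0`). -/
theorem quietPolar_of_tameKantorovich
    (h : ∃ (γ C₁ C₂ ν₁ σ₀ : ℝ) (p : ℕ), γ < 1 ∧ 0 < ν₁ ∧ 0 < σ₀ ∧ 0 ≤ C₂ ∧ TameFirstStep σ₀ C₂ ν₁ ∧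
      ∀ σ σ' : ℝ, 0 < σ' → σ' < σ → σ ≤ σ₀ → PseudospectralBound γ (C₁ / (σ - σ') ^ p) ν₁ σ σ' (4 * C₂)) :
    QuietPolarSteadyStates := by
  sorry

/-- **Consequence for the crux** (composition with the strategist's `not_noScreening_of_polar`). -/
theorem not_noScreening_of_tameKantorovich
    (hK : Summit.AnomalousDissipation.AnomalousDissipation.Cruxes.NoScreening.KleinPole.PolarKleinOrbit)
    (h : ∃ (γ C₁ C₂ ν₁ σ₀ : ℝ) (p : ℕ), γ < 1 ∧ 0 < ν₁ ∧ 0 < σ₀ ∧ 0 ≤ C₂ ∧ TameFirstStep σ₀ C₂ ν₁ ∧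
      ∀ σ σ' : ℝ, 0 < σ' → σ' < σ → σ ≤ σ₀ → PseudospectralBound γ (C₁ / (σ - σ') ^ p) ν₁ σ σ' (4 * C₂)) :
    ¬ Summit.AnomalousDissipation.AnomalousDissipation.Theses.StirringSphere.NoScreening :=
  Summit.AnomalousDissipation.AnomalousDissipation.Cruxes.NoScreening.KleinPole.not_noScreening_of_polar hK
    (quietPolar_of_tameKantorovich h)

/-! ### Borderline form (γ = 1 with constants): ν-uniform Kantorovich number along a sequence -/

/-- Symmetric data/unknowns for the borderline form: admissible (smooth, solenoidal, mean-zero, `PT`-symmetric)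
AND invariant under the coordinate permutations `S₃` acting on points and components (the full stabiliser of
`(u⋆, −b₂)`; Kantorovich needs invertibility only on its fixed space). -/
def IsSymmField (g : 𝕋³ → E³) : Prop :=
  IsAdmissibleField g ∧ ∀ (σ : Equiv.Perm (Fin 3)) (x : 𝕋³),
    g (fun i => x (σ i)) = (WithLp.toLp 2 fun i => g x (σ i) : E³)

/-- The `H²(T³)` norm of a real vector field (via the tree's complexification, as in `TorusSobolevNorm`). -/
def h2Norm (w : 𝕋³ → E³) : ℝ :=
  Literature.Analysis.FunctionSpaces.Torus.sobolevNorm 2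
    (Literature.Analysis.FunctionSpaces.EuclideanSpace.complexify ∘ w)

/-- **ν-uniform Kantorovich data along a sequence `ν → 0`** (everything at FIXED viscosity, `H²` norms, no loss):
for arbitrarily small `ν` — a sequence suffices for `QuietPolarSteadyStates`, and generic `ν` avoid the isolated
symmetry-breaking eigenvalue crossings — the linearisation `L(ν,u⋆)` is kernel-free on symmetric fields, the first
Newton step is tame (`‖δ₁‖_{H²} ≤ Cν`), and the simplified-Newton Lipschitz map `(v,w) ↦ L(ν,u⋆)^{-1}[(v·∇)w + (w·∇)v]`
(pressure absorbed by the resolvent relation) has a constant `ω(ν)` with Kantorovich number `Cν·ω(ν) ≤ h₀`.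
Numerically (kit j026477, K = 8, sector `Fix(S₃×PT)`): `‖δ₁‖/ν = 15.3 … 22.7` and the Kantorovich proxy
`h ≈ 0.19, 0.19, 0.17, 0.16, 0.15, 0.16` at `ν = 0.02, 0.01, 0.005, 0.0035, 0.0025, 0.0018` — flat and `< ½`,
while `σ_min(L(ν,u⋆)|_{Fix}) ≈ (60–110)·ν` (the viscous lift of the exact kernel of `L_{u⋆}`): `γ = 1`, good constants. -/
def UniformKantorovich (h₀ C : ℝ) : Prop :=
  ∀ ν₀ : ℝ, 0 < ν₀ → ∃ ν ω : ℝ, 0 < ν ∧ ν < ν₀ ∧ 0 ≤ ω ∧ C * ν * ω ≤ h₀ ∧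
    (∀ z : 𝕋³ → E³, IsSymmField z →
      Literature.Analysis.FluidPDE.Torus.LinNSResolventRel ν uStar 0 (rtc z) (fun _ => 0) → z = 0) ∧
    (∃ δ : 𝕋³ → E³, IsSymmField δ ∧
      Literature.Analysis.FluidPDE.Torus.LinNSResolventRel ν uStar 0 (rtc δ) (rtc (fun x => (4 * π ^ 2 * ν) • uStar x)) ∧
      h2Norm δ ≤ C * ν) ∧
    (∀ v w : 𝕋³ → E³, IsSymmField v → IsSymmField w →
      ∃ z : 𝕋³ → E³, IsSymmField z ∧
        Literature.Analysis.FluidPDE.Torus.LinNSResolventRel ν uStar 0 (rtc z)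
          (rtc (fun x => Literature.Analysis.FunctionSpaces.Torus.convect v w x +
            Literature.Analysis.FunctionSpaces.Torus.convect w v x)) ∧
        h2Norm z ≤ ω * h2Norm v * h2Norm w)

/-- **FIRST LEMMA, borderline form (size L; fixed-ν functional analysis + `newtonKantorovich_quadratic`).**
A ν-uniform Kantorovich number `h₀ < ½` along a sequence gives, at each such `ν`, a symmetric steady state of
`NS_ν(−b₂)` within `2Cν` of `u⋆` in `H²` (simplified-Newton contraction), hence `QuietPolarSteadyStates`
(energy `→ 3/(2π) < ½`, `|(u,b₂)| = ν‖∇u‖² → 0`). This is the form the symmetric-sector numerics support. -/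
theorem quietPolar_of_uniformKantorovich
    (h : ∃ h₀ C : ℝ, h₀ < 1 / 2 ∧ 0 ≤ C ∧ UniformKantorovich h₀ C) :
    QuietPolarSteadyStates := by
  sorry

/-! ### The abstract core (Mathlib-only; provable now, size M) -/

/-- **Newton–Kantorovich for quadratic maps.** `F(x) = L x + B(x,x) − c` on a real Banach space, `J⁻¹` a
two-sided inverse (`hleft`, `hright`) of `F'(x₀) = L + B(x₀,·) + B(·,x₀)`; if `η := ‖J⁻¹F(x₀)‖` and `ω := 2‖J⁻¹ ∘ B‖`
satisfy `ηω < ½` then `F` has a zero within `2η` of `x₀` (simplified-Newton contraction on that ball).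
Here `J⁻¹ ∘ B` enters as ONE bilinear map `JB` — the quantity the pseudospectral bound must control. -/
theorem newtonKantorovich_quadratic {X : Type*} [NormedAddCommGroup X] [NormedSpace ℝ X] [CompleteSpace X]
    (L Jinv : X →L[ℝ] X) (B JB : X →L[ℝ] X →L[ℝ] X) (c x₀ : X)
    (hJB : ∀ u v, JB u v = Jinv (B u v))
    (hleft : ∀ v, Jinv (L v + B x₀ v + B v x₀) = v)
    (hright : ∀ v, L (Jinv v) + B x₀ (Jinv v) + B (Jinv v) x₀ = v)
    (η ω : ℝ) (hη : ‖Jinv (L x₀ + B x₀ x₀ - c)‖ ≤ η) (hω : 2 * ‖JB‖ ≤ ω) (h : η * ω < 1 / 2) :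
    ∃ x : X, L x + B x x = c ∧ ‖x - x₀‖ ≤ 2 * η := by
  sorry

end Summit.AnomalousDissipation.AnomalousDissipation.Cruxes.NoScreening.TameKantorovich

end
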